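import Summits.QuantumFields.YangMills.Theorems.BalabanUVNodesN19CosineSeriesSmooth
import Mathlib.Algebra.Ring.GeomSum

/-!
# YM-DAG node N19 (= NE7 proper) — THE LOWER SIDE OF THE KINK, PART 1: the sine moments `J(n, L) = ∫_0^π sin^n u·cos(Lu) du`
# (recurrence, annihilation of even powers, SIGN-COHERENT closed form of odd powers) and the shifted Fejér kernel

Cell `pub-ymgap`, HUMAN RULING D-0062 (Track A) ∕ D-0149 (work-bound push), R141 (C) wider-strategy seat `pub-ymgap-dag-n19-e` (strategy
s3 = ALTERNATIVE CURRENCY), generation g31, module 1 (lineage module 132).  Route `Summits/QuantumFields/YangMills/Theses/BalabanUVNodes.lean`,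
cluster item K3⁸ «SpineGivenEndpointR13SepCoPHV» (stmt-QuantumFields-27366); filed `--supports` that item `--as helper` (it proves no registered
stub).  COUNT-NEUTRAL: [folklore] one-dimensional trigonometric bookkeeping over Mathlib (`intervalIntegral`) and, BY NAME, module 123
`…N19CosineSeriesSmooth` (`integral_mul_cos_eq`: two integrations by parts against a cosine); no laws, no scheme object, no Theses import;
NOT a discharge claim.

THE QUESTION (HOME `CURRENCY-MAP.md` v9, open item «a typed LOWER bound for the single mode»).  Modules 119∕122 type the single-mode law
`dist_∞(e^{iωΣ_{i≤d}|x_i|}, Π_t) ≤ 300·log₂t·(log₂t + 4ωd)∕t` — upper side only; along the diagonal the imaginary part is `sin(a|s|)`, `a = ωd`,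
a KINK of slope jump `2a` at `s = 0`, and the arc-law functionals of modules 72∕87 pay only `≍ a∕t²` for it.  PART 2 (`…N19KinkLowerBound`)
types the classical `≍ a∕t` lower side with a de la Vallée-Poussin ∕ Fejér annihilating functional; this PART 1 supplies its two ingredients.

§1 THE SINE MOMENTS `J(n, L) = ∫_0^π sin^n u·cos(Lu) du` (`L ≥ 1` an integer): `integral_mul_cos_nat_eq` (module 123's formula at `d = π`) ·
★ `sin_pow_moment_recurrence` (`((n+2)² − L²)·J(n+2, L) = (n+2)(n+1)·J(n, L)`: `(sin^{n+2})″ = (n+2)(n+1)sin^n − (n+2)²sin^{n+2}`, the boundary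
terms vanish) · `integral_cos_nat_mul_eq_zero` (`J(0, L) = 0`) · `integral_sin_mul_cos_nat` (`(L² − 1)J(1, L) = −(1 + cos πL)`) ·
★ `integral_sin_pow_even_mul_cos_eq_zero` (`J(2k, L) = 0` for `2k < L`) · `prod_sq_sub_odd_sq_pos` · ★★ `integral_sin_pow_odd_mul_cos` — THE
SIGN-COHERENT CLOSED FORM `J(2k+1, L) = (−1)^{k+1}(2k+1)!·(1 + cos πL)∕∏_{i≤k}(L² − (2i+1)²)` for `L ≥ 2k+2`: multiplied by the sine Taylor
coefficient `(−1)^k a^{2k+1}∕(2k+1)!` it is `−a^{2k+1}(1 + cos πL)∕∏(…) ≤ 0` for EVERY `k` and EVERY admissible `L` (PART 2 sums these without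
cancellation).
§2 THE SHIFTED FEJÉR KERNEL `D(u) = Σ_{j,j'≤m} cos((T+m+j−j')u)` (the tree's `Literature.Probability.LatticeModels.fejerKernel`, up to
normalisation, modulated to the frequency band `[T, T+2m]`): `cast_freq` · ★ `doubleCosSum_eq` (`D(u) = cos((T+m)u)·((Σ_j cos ju)² + (Σ_j sin ju)²)`)
· `fejerFactor_eq` · `abs_doubleCosSum_le` (`|D| ≤` the Fejér factor) · `neg_one_le_doubleCosSum_pi` (`D(π) ≥ −1`) · `integral_cos_sub_freq` ·
★ `integral_fejerFactor` (`∫_0^π ((Σ_j cos ju)² + (Σ_j sin ju)²) du = π(m+1)`).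

HONEST FRAMING (binding).  Elementary and [folklore]; NO consumer in the DAG today (tooling for the lower side of an optimality map of the seat's
own currency, degree model); nothing of Bałaban's instantiated; NE7 NOT PRINTED, NOT proved; N19 NOT discharged; count-neutral.  One finite `T⁴`
programme at fixed `ε`; nothing continuum ∕ `ℝ⁴` ∕ OS ∕ mass-gap ∕ Clay.  0 `def` ∕ 0 `sorry`.
-/

noncomputable section

open Finset Real MeasureTheory intervalIntegral

namespace Summit.QuantumFields.YangMills.Theorems.BalabanUVNodesN19ShiftedFejerKernel

open Summit.QuantumFields.YangMills.Theorems.BalabanUVNodesN19CosineSeriesSmooth (integral_mul_cos_eq)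

/-! ## §1 The trigonometric moments `J(n, L) = ∫_0^π sin^n u·cos(Lu) du` [folklore] -/

/-- Two integrations by parts on `[0, π]` against `cos(Lu)`, `L ≥ 1` an integer (module 123's `integral_mul_cos_eq` at `d = π`):
`∫_0^π h cos(L·) = (h'(π)cos(πL) − h'(0))∕L² − (∫_0^π h'' cos(L·))∕L²`. [folklore] -/
theorem integral_mul_cos_nat_eq {h h' h'' : ℝ → ℝ} (hh : ∀ s, HasDerivAt h (h' s) s)
    (hh' : ∀ s, HasDerivAt h' (h'' s) s) (hh'' : Continuous h'') {L : ℕ} (hL : 1 ≤ L) :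
    ∫ s in (0 : ℝ)..π, h s * Real.cos (L * s) =
      (h' π * Real.cos (π * L) - h' 0) / (L : ℝ) ^ 2 -
        (∫ s in (0 : ℝ)..π, h'' s * Real.cos (L * s)) / (L : ℝ) ^ 2 := by
  have key := integral_mul_cos_eq hh hh' hh'' Real.pi_pos hL
  have hL0 : (L : ℝ) ≠ 0 := by positivity
  have e1 : (π * L / π : ℝ) = L := by field_simp
  simp only [e1] at key
  rw [key]
  field_simp

/-- Integrability bookkeeping: `u ↦ sin^n u·cos(Lu)` is interval integrable. [bookkeeping] -/
theorem intervalIntegrable_sin_pow_mul_cos (n : ℕ) (L a b : ℝ) :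
    IntervalIntegrable (fun s => Real.sin s ^ n * Real.cos (L * s)) volume a b :=
  (by fun_prop : Continuous fun s => Real.sin s ^ n * Real.cos (L * s)).intervalIntegrable _ _

/-- THE RECURRENCE `((n+2)² − L²)·J(n+2, L) = (n+2)(n+1)·J(n, L)` (`L ≥ 1`). [folklore] -/
theorem sin_pow_moment_recurrence (n : ℕ) {L : ℕ} (hL : 1 ≤ L) :
    (((n : ℝ) + 2) ^ 2 - (L : ℝ) ^ 2) * ∫ s in (0 : ℝ)..π, Real.sin s ^ (n + 2) * Real.cos (L * s) =
      ((n : ℝ) + 2) * ((n : ℝ) + 1) * ∫ s in (0 : ℝ)..π, Real.sin s ^ n * Real.cos (L * s) := by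
  have hL0 : (L : ℝ) ≠ 0 := by positivity
  have hh : ∀ s, HasDerivAt (fun s => Real.sin s ^ (n + 2))
      (((n : ℝ) + 2) * Real.sin s ^ (n + 1) * Real.cos s) s := by
    intro s
    refine ((Real.hasDerivAt_sin s).fun_pow (n + 2)).congr_deriv ?_
    rw [show n + 2 - 1 = n + 1 by omega]
    push_cast
    ring
  have hh' : ∀ s, HasDerivAt (fun s => ((n : ℝ) + 2) * Real.sin s ^ (n + 1) * Real.cos s)
      (((n : ℝ) + 2) * ((n : ℝ) + 1) * Real.sin s ^ n - ((n : ℝ) + 2) ^ 2 * Real.sin s ^ (n + 2)) s := by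
    intro s
    have h1 := (((Real.hasDerivAt_sin s).fun_pow (n + 1)).const_mul ((n : ℝ) + 2)).fun_mul
      (Real.hasDerivAt_cos s)
    refine h1.congr_deriv ?_
    rw [show n + 1 - 1 = n by omega]
    push_cast
    linear_combination ((n : ℝ) + 2) * ((n : ℝ) + 1) * Real.sin s ^ n * Real.sin_sq_add_cos_sq s
  have hh'' : Continuous fun s =>
      ((n : ℝ) + 2) * ((n : ℝ) + 1) * Real.sin s ^ n - ((n : ℝ) + 2) ^ 2 * Real.sin s ^ (n + 2) := by
    fun_prop
  have key := integral_mul_cos_nat_eq hh hh' hh'' hL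
  have hsplit : ∫ s in (0 : ℝ)..π,
      (((n : ℝ) + 2) * ((n : ℝ) + 1) * Real.sin s ^ n - ((n : ℝ) + 2) ^ 2 * Real.sin s ^ (n + 2)) *
        Real.cos (L * s) =
      ((n : ℝ) + 2) * ((n : ℝ) + 1) * (∫ s in (0 : ℝ)..π, Real.sin s ^ n * Real.cos (L * s)) -
        ((n : ℝ) + 2) ^ 2 * ∫ s in (0 : ℝ)..π, Real.sin s ^ (n + 2) * Real.cos (L * s) := by
    rw [← intervalIntegral.integral_const_mul, ← intervalIntegral.integral_const_mul,
      ← intervalIntegral.integral_sub]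
    · exact intervalIntegral.integral_congr fun s _ => by ring
    · exact (intervalIntegrable_sin_pow_mul_cos n L 0 π).const_mul _
    · exact (intervalIntegrable_sin_pow_mul_cos (n + 2) L 0 π).const_mul _
  rw [hsplit, Real.sin_zero, Real.sin_pi, zero_pow (Nat.succ_ne_zero n)] at key
  simp only [mul_zero, zero_mul, sub_zero, zero_div, zero_sub] at key
  field_simp at key
  linear_combination -key

/-- `J(0, L) = ∫_0^π cos(Lu) du = 0` for `L ≥ 1`. [folklore] -/
theorem integral_cos_nat_mul_eq_zero {L : ℕ} (hL : 1 ≤ L) :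
    ∫ s in (0 : ℝ)..π, Real.sin s ^ 0 * Real.cos (L * s) = 0 := by
  have hh : ∀ s : ℝ, HasDerivAt (fun _ : ℝ => (1 : ℝ)) ((fun _ => (0 : ℝ)) s) s := fun s => hasDerivAt_const s 1
  have hh' : ∀ s : ℝ, HasDerivAt (fun _ : ℝ => (0 : ℝ)) ((fun _ => (0 : ℝ)) s) s := fun s => hasDerivAt_const s 0
  have key := integral_mul_cos_nat_eq hh hh' continuous_const hL
  simp only [zero_mul, sub_zero, zero_div, intervalIntegral.integral_zero, one_mul] at key
  simpa only [pow_zero, one_mul] using key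

/-- `(L² − 1)·J(1, L) = −(1 + cos πL)` for `L ≥ 1`. [folklore] -/
theorem integral_sin_mul_cos_nat {L : ℕ} (hL : 1 ≤ L) :
    ((L : ℝ) ^ 2 - 1) * ∫ s in (0 : ℝ)..π, Real.sin s * Real.cos (L * s) = -(1 + Real.cos (π * L)) := by
  have hL0 : (L : ℝ) ≠ 0 := by positivity
  have key := integral_mul_cos_nat_eq (h := Real.sin) (h' := Real.cos) (h'' := fun s => -Real.sin s)
    Real.hasDerivAt_sin Real.hasDerivAt_cos (by fun_prop) hL
  have hneg : ∫ s in (0 : ℝ)..π, -Real.sin s * Real.cos (L * s) =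
      -∫ s in (0 : ℝ)..π, Real.sin s * Real.cos (L * s) := by
    rw [← intervalIntegral.integral_neg]
    exact intervalIntegral.integral_congr fun s _ => by ring
  rw [hneg, Real.cos_zero, Real.cos_pi] at key
  set C := Real.cos (π * (L : ℝ)) with hC
  field_simp at key
  linear_combination key

/-- EVEN powers below the frequency are annihilated: `J(2k, L) = 0` for `2k < L`. [folklore] -/
theorem integral_sin_pow_even_mul_cos_eq_zero (k : ℕ) {L : ℕ} (hkL : 2 * k < L) :
    ∫ s in (0 : ℝ)..π, Real.sin s ^ (2 * k) * Real.cos (L * s) = 0 := by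
  have hL : 1 ≤ L := by omega
  induction k with
  | zero => simpa using integral_cos_nat_mul_eq_zero hL
  | succ k ih =>
    have ih' := ih (by omega)
    have hrec := sin_pow_moment_recurrence (2 * k) hL
    rw [show 2 * k + 2 = 2 * (k + 1) by ring, ih', mul_zero] at hrec
    have hne : (((2 * k : ℕ) : ℝ) + 2) ^ 2 - (L : ℝ) ^ 2 ≠ 0 := by
      have hlt : ((2 * k : ℕ) : ℝ) + 2 < L := by exact_mod_cast (show 2 * k + 2 < L by omega)
      have h0 : (0 : ℝ) ≤ ((2 * k : ℕ) : ℝ) + 2 := by positivity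
      have := pow_lt_pow_left₀ hlt h0 two_ne_zero
      linarith
    exact (mul_eq_zero.1 hrec).resolve_left hne

/-- The denominators: `∏_{i≤k}(L² − (2i+1)²) > 0` for `L ≥ 2k+2`. [bookkeeping] -/
theorem prod_sq_sub_odd_sq_pos (k : ℕ) {L : ℕ} (hkL : 2 * k + 2 ≤ L) :
    0 < ∏ i ∈ range (k + 1), ((L : ℝ) ^ 2 - (2 * i + 1) ^ 2) := by
  refine Finset.prod_pos fun i hi => ?_
  have hi' : i ≤ k := Nat.lt_succ_iff.1 (Finset.mem_range.1 hi)
  have hlt : (2 * (i : ℝ) + 1) < L := by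
    have : 2 * i + 1 < L := by omega
    exact_mod_cast this
  have h0 : (0 : ℝ) ≤ 2 * (i : ℝ) + 1 := by positivity
  have := pow_lt_pow_left₀ hlt h0 two_ne_zero
  linarith

/-- THE SIGN-COHERENT CLOSED FORM of the odd moments: for `L ≥ 2k+2`,
`J(2k+1, L) = (−1)^{k+1}(2k+1)!·(1 + cos πL)∕∏_{i≤k}(L² − (2i+1)²)`. [folklore] -/
theorem integral_sin_pow_odd_mul_cos (k : ℕ) {L : ℕ} (hkL : 2 * k + 2 ≤ L) :
    ∫ s in (0 : ℝ)..π, Real.sin s ^ (2 * k + 1) * Real.cos (L * s) =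
      (-1) ^ (k + 1) * ((2 * k + 1).factorial : ℝ) * (1 + Real.cos (π * L)) /
        ∏ i ∈ range (k + 1), ((L : ℝ) ^ 2 - (2 * i + 1) ^ 2) := by
  have hL : 1 ≤ L := by omega
  induction k with
  | zero =>
    have h1 := integral_sin_mul_cos_nat hL
    have hne : (L : ℝ) ^ 2 - 1 ≠ 0 := by
      have h2 : (2 : ℝ) ≤ L := by exact_mod_cast (show 2 ≤ L by omega)
      nlinarith
    simp only [mul_zero, zero_add, pow_one, Nat.factorial_one, Nat.cast_one, mul_one, Finset.prod_range_one,
      Nat.cast_zero, one_pow]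
    rw [eq_div_iff hne]
    linear_combination h1
  | succ k ih =>
    have ih' := ih (by omega)
    have hrec := sin_pow_moment_recurrence (2 * k + 1) hL
    have hne : (((2 * k + 1 : ℕ) : ℝ) + 2) ^ 2 - (L : ℝ) ^ 2 ≠ 0 := by
      have hlt : ((2 * k + 1 : ℕ) : ℝ) + 2 < L := by exact_mod_cast (show 2 * k + 1 + 2 < L by omega)
      have h0 : (0 : ℝ) ≤ ((2 * k + 1 : ℕ) : ℝ) + 2 := by positivity
      have := pow_lt_pow_left₀ hlt h0 two_ne_zero
      linarith
    have hprod := (prod_sq_sub_odd_sq_pos k (by omega : 2 * k + 2 ≤ L)).ne'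
    rw [show 2 * (k + 1) + 1 = 2 * k + 1 + 2 by ring]
    have hJ : ∫ s in (0 : ℝ)..π, Real.sin s ^ (2 * k + 1 + 2) * Real.cos (L * s) =
        (((2 * k + 1 : ℕ) : ℝ) + 2) * (((2 * k + 1 : ℕ) : ℝ) + 1) *
          (∫ s in (0 : ℝ)..π, Real.sin s ^ (2 * k + 1) * Real.cos (L * s)) /
          ((((2 * k + 1 : ℕ) : ℝ) + 2) ^ 2 - (L : ℝ) ^ 2) := by
      rw [eq_div_iff hne, mul_comm, hrec]
    have hf3 : (((2 * k + 1 + 2).factorial : ℕ) : ℝ) = (2 * k + 3) * (2 * k + 2) * (2 * k + 1).factorial := by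
      rw [show 2 * k + 1 + 2 = 2 * k + 1 + 1 + 1 by ring, Nat.factorial_succ, Nat.factorial_succ]
      push_cast
      ring
    rw [hJ, ih', Finset.prod_range_succ (fun i => ((L : ℝ) ^ 2 - (2 * i + 1) ^ 2)) (k + 1), hf3]
    have hlast : (L : ℝ) ^ 2 - (2 * ((k + 1 : ℕ) : ℝ) + 1) ^ 2 ≠ 0 := by
      have hlt : (2 * ((k + 1 : ℕ) : ℝ) + 1) < L := by exact_mod_cast (show 2 * (k + 1) + 1 < L by omega)
      have h0 : (0 : ℝ) ≤ 2 * ((k + 1 : ℕ) : ℝ) + 1 := by positivity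
      have := pow_lt_pow_left₀ hlt h0 two_ne_zero
      linarith
    set C := Real.cos (π * (L : ℝ)) with hC
    rw [mul_div_assoc', div_div, div_eq_div_iff (mul_ne_zero hprod hne) (mul_ne_zero hprod hlast)]
    push_cast
    ring

/-! ## §2 The shifted Fejér kernel `D(u) = Σ_{j,j'≤m} cos((T+m+j−j')u)` [folklore] -/

/-- The frequencies are natural numbers `≥ T`: the cast of `T + m + j − j'` (`j' ≤ m`). [bookkeeping] -/
theorem cast_freq {T m j j' : ℕ} (hj' : j' ≤ m) :
    (((T + m + j - j' : ℕ) : ℝ)) = (T : ℝ) + m + j - j' := by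
  rw [Nat.cast_sub (by omega)]
  push_cast
  ring

/-- **THE SHIFTED FEJÉR KERNEL IS A MODULATED FEJÉR KERNEL.**
`Σ_{j,j'≤m} cos((T+m+j−j')u) = cos((T+m)u)·((Σ_{j≤m} cos ju)² + (Σ_{j≤m} sin ju)²)`. [folklore] -/
theorem doubleCosSum_eq (T m : ℕ) (u : ℝ) :
    ∑ j ∈ range (m + 1), ∑ j' ∈ range (m + 1), Real.cos (((T + m + j - j' : ℕ) : ℝ) * u) =
      Real.cos (((T : ℝ) + m) * u) *
        ((∑ j ∈ range (m + 1), Real.cos (j * u)) ^ 2 + (∑ j ∈ range (m + 1), Real.sin (j * u)) ^ 2) := by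
  have hterm : ∀ j ∈ range (m + 1), ∀ j' ∈ range (m + 1),
      Real.cos (((T + m + j - j' : ℕ) : ℝ) * u) =
        Real.cos (((T : ℝ) + m) * u) * (Real.cos (j * u) * Real.cos (j' * u) + Real.sin (j * u) * Real.sin (j' * u)) -
          Real.sin (((T : ℝ) + m) * u) * (Real.sin (j * u) * Real.cos (j' * u) - Real.cos (j * u) * Real.sin (j' * u)) := by
    intro j _ j' hj'
    rw [cast_freq (Nat.lt_succ_iff.1 (Finset.mem_range.1 hj')),
      show ((T : ℝ) + m + j - j') * u = ((T : ℝ) + m) * u + (j * u - j' * u) by ring, Real.cos_add, Real.cos_sub,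
      Real.sin_sub]
  rw [Finset.sum_congr rfl fun j hj => Finset.sum_congr rfl fun j' hj' => hterm j hj j' hj']
  have hX : ∑ j ∈ range (m + 1), ∑ j' ∈ range (m + 1),
      Real.cos (((T : ℝ) + m) * u) * (Real.cos (j * u) * Real.cos (j' * u) + Real.sin (j * u) * Real.sin (j' * u)) =
      Real.cos (((T : ℝ) + m) * u) *
        ((∑ j ∈ range (m + 1), Real.cos (j * u)) ^ 2 + (∑ j ∈ range (m + 1), Real.sin (j * u)) ^ 2) := by
    rw [sq, sq, Finset.sum_mul_sum, Finset.sum_mul_sum, ← Finset.sum_add_distrib, Finset.mul_sum]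
    refine Finset.sum_congr rfl fun j _ => ?_
    rw [← Finset.sum_add_distrib, Finset.mul_sum]
  have hY : ∑ j ∈ range (m + 1), ∑ j' ∈ range (m + 1),
      Real.sin (((T : ℝ) + m) * u) * (Real.sin (j * u) * Real.cos (j' * u) - Real.cos (j * u) * Real.sin (j' * u)) =
      0 := by
    have h0 : ∑ j ∈ range (m + 1), ∑ j' ∈ range (m + 1),
        Real.sin (((T : ℝ) + m) * u) * (Real.sin (j * u) * Real.cos (j' * u) - Real.cos (j * u) * Real.sin (j' * u)) =
        Real.sin (((T : ℝ) + m) * u) *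
          ((∑ j ∈ range (m + 1), Real.sin (j * u)) * (∑ j ∈ range (m + 1), Real.cos (j * u)) -
            (∑ j ∈ range (m + 1), Real.cos (j * u)) * (∑ j ∈ range (m + 1), Real.sin (j * u))) := by
      rw [Finset.sum_mul_sum, Finset.sum_mul_sum, ← Finset.sum_sub_distrib, Finset.mul_sum]
      refine Finset.sum_congr rfl fun j _ => ?_
      rw [← Finset.sum_sub_distrib, Finset.mul_sum]
    rw [h0]
    ring
  simp only [Finset.sum_sub_distrib]
  rw [hX, hY, sub_zero]

/-- The Fejér factor as a double cosine sum: `(Σ_j cos ju)² + (Σ_j sin ju)² = Σ_{j,j'} cos((j − j')u)`. [folklore] -/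
theorem fejerFactor_eq (m : ℕ) (u : ℝ) :
    (∑ j ∈ range (m + 1), Real.cos (j * u)) ^ 2 + (∑ j ∈ range (m + 1), Real.sin (j * u)) ^ 2 =
      ∑ j ∈ range (m + 1), ∑ j' ∈ range (m + 1), Real.cos ((j : ℝ) * u - j' * u) := by
  simp only [Real.cos_sub, Finset.sum_add_distrib, sq, Finset.sum_mul_sum]

/-- `|D(u)| ≤ (Σ_j cos ju)² + (Σ_j sin ju)²`. [folklore] -/
theorem abs_doubleCosSum_le (T m : ℕ) (u : ℝ) :
    |∑ j ∈ range (m + 1), ∑ j' ∈ range (m + 1), Real.cos (((T + m + j - j' : ℕ) : ℝ) * u)| ≤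
      (∑ j ∈ range (m + 1), Real.cos (j * u)) ^ 2 + (∑ j ∈ range (m + 1), Real.sin (j * u)) ^ 2 := by
  rw [doubleCosSum_eq, abs_mul]
  have hF : 0 ≤ (∑ j ∈ range (m + 1), Real.cos (j * u)) ^ 2 + (∑ j ∈ range (m + 1), Real.sin (j * u)) ^ 2 := by
    positivity
  rw [abs_of_nonneg hF]
  calc |Real.cos (((T : ℝ) + m) * u)| * _ ≤ 1 * _ :=
        mul_le_mul_of_nonneg_right (Real.abs_cos_le_one _) hF
    _ = _ := one_mul _

/-- `D(π) ≥ −1` (at `u = π` the Fejér factor is `(Σ_j (−1)^j)² ≤ 1`). [folklore] -/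
theorem neg_one_le_doubleCosSum_pi (T m : ℕ) :
    -1 ≤ ∑ j ∈ range (m + 1), ∑ j' ∈ range (m + 1), Real.cos (((T + m + j - j' : ℕ) : ℝ) * π) := by
  rw [doubleCosSum_eq]
  have hsin : ∑ j ∈ range (m + 1), Real.sin (j * π) = 0 :=
    Finset.sum_eq_zero fun j _ => Real.sin_nat_mul_pi j
  have hcos : ∑ j ∈ range (m + 1), Real.cos (j * π) = ∑ j ∈ range (m + 1), (-1 : ℝ) ^ j :=
    Finset.sum_congr rfl fun j _ => Real.cos_nat_mul_pi j
  rw [hsin, hcos, neg_one_geom_sum]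
  have hc1 := Real.abs_cos_le_one (((T : ℝ) + m) * π)
  rw [abs_le] at hc1
  split_ifs <;> nlinarith [hc1.1, hc1.2]

/-- `∫_0^π cos(ju − j'u) du = π·[j = j']` for naturals `j, j'`. [folklore] -/
theorem integral_cos_sub_freq (j j' : ℕ) :
    ∫ s in (0 : ℝ)..π, Real.cos ((j : ℝ) * s - j' * s) = if j = j' then π else 0 := by
  split_ifs with h
  · subst h
    simp
  · have hc : ((j : ℝ) - j') ≠ 0 := sub_ne_zero.2 (by exact_mod_cast h)
    have heq : (fun s : ℝ => Real.cos ((j : ℝ) * s - j' * s)) = fun s => Real.cos (((j : ℝ) - j') * s) := by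
      funext s; ring_nf
    rw [heq, intervalIntegral.integral_comp_mul_left (fun s => Real.cos s) hc, integral_cos]
    simp only [mul_zero, Real.sin_zero, sub_zero, smul_eq_mul]
    rw [show ((j : ℝ) - j') * π = j * π - j' * π by ring, Real.sin_sub, Real.sin_nat_mul_pi, Real.sin_nat_mul_pi]
    simp

/-- THE MASS OF THE FEJÉR FACTOR: `∫_0^π ((Σ_{j≤m} cos ju)² + (Σ_{j≤m} sin ju)²) du = π(m+1)`. [folklore] -/
theorem integral_fejerFactor (m : ℕ) :
    ∫ s in (0 : ℝ)..π,
        ((∑ j ∈ range (m + 1), Real.cos (j * s)) ^ 2 + (∑ j ∈ range (m + 1), Real.sin (j * s)) ^ 2) =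
      π * (m + 1) := by
  have hint : ∀ j j' : ℕ, IntervalIntegrable (fun s : ℝ => Real.cos ((j : ℝ) * s - j' * s)) volume 0 π :=
    fun j j' => (by fun_prop : Continuous fun s : ℝ => Real.cos ((j : ℝ) * s - j' * s)).intervalIntegrable _ _
  simp_rw [fejerFactor_eq]
  calc ∫ s in (0 : ℝ)..π, ∑ j ∈ range (m + 1), ∑ j' ∈ range (m + 1), Real.cos ((j : ℝ) * s - j' * s)
      = ∑ j ∈ range (m + 1), ∫ s in (0 : ℝ)..π, ∑ j' ∈ range (m + 1), Real.cos ((j : ℝ) * s - j' * s) :=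
        intervalIntegral.integral_finsetSum fun j _ =>
          (by fun_prop : Continuous fun s : ℝ =>
            ∑ j' ∈ range (m + 1), Real.cos ((j : ℝ) * s - j' * s)).intervalIntegrable _ _
    _ = ∑ j ∈ range (m + 1), ∑ j' ∈ range (m + 1), ∫ s in (0 : ℝ)..π, Real.cos ((j : ℝ) * s - j' * s) :=
        Finset.sum_congr rfl fun j _ => intervalIntegral.integral_finsetSum fun j' _ => hint j j'
    _ = ∑ j ∈ range (m + 1), ∑ j' ∈ range (m + 1), (if j = j' then π else 0) := by
        simp_rw [integral_cos_sub_freq]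
    _ = ∑ j ∈ range (m + 1), π := Finset.sum_congr rfl fun j hj => by rw [Finset.sum_ite_eq, if_pos hj]
    _ = π * (m + 1) := by simp [Finset.sum_const, mul_comm]

end Summit.QuantumFields.YangMills.Theorems.BalabanUVNodesN19ShiftedFejerKernel

end
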